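import Summits.ResolutionOfSingularities.ResolutionOfSingularities.Theses.FrobeniusClosing
import Literature.Barriers.ResolutionOfSingularities.ResidualOrderUnboundedExample1Cycle
import Literature.Barriers.ResolutionOfSingularities.ResidualOrderUnboundedExample2Cycle
import HarnessLib

/-!
# [OURS · L1 W4.7] The Hauser–Perlega cycles are UNFORCED at every stage
# (negative-side support for `IsolatedForcedTermination`, stmt-ResolutionOfSingularities-16343;
# campaign W4.7 disprover seat; this file does NOT refute the thesis and is NOT a statement of the
# manuscript — it replaces the role of "a candidate divergent family is a forced isolated run")

The thesis `IsolatedForcedTermination` (route `FrobeniusClosing`) says that no infinite run of the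
point-blow-up dynamics of a height-one atom consists of ISOLATED states of multiplicity `p`.  The only
divergent point-blow-up families in print are the two Hauser–Perlega cycles
(`HauserPerlega.Example1.seq`, characteristic `2`, `f = z⁸ + F(x,y,u,v,w)`;
`HauserPerlega.Example2.seq`, characteristic `p = 2h+1`, `f = z^{p³} + F(x,y,v,w)`), formalised in
`Literature/Barriers/ResolutionOfSingularities/ResidualOrderUnboundedExample{1,2}Cycle.lean`.

Hauser–Perlega themselves remark "Taking larger centers would prevent the phenomenon from happening.
We were not able to construct examples with cycles where the choice of point centers is forced (e.g.,
because the singularities are isolated)" [cite: HauserPerlega2019, §1] and, for the starting polynomial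
of the second example, "Note that `(z,x,w)` and `(z,v,w)` are also admissible centers at the beginning"
[cite: HauserPerlega2019, §5].  Here we record, sorry-free and from the tree's own stage invariants
(`Example1.stateShape_seq`, `Example2.stateShape_seq`), that this holds at EVERY stage `k` of both
sequences, not only at the beginning:

* `example1_seq_mem_pow` : `F¹_k ∈ (x, w)⁸` for all `k` (hence `f_k = z⁸ + F¹_k ∈ (z, x, w)⁸`,
  `example1_equation_mem_pow`), and every monomial of `F¹_k` has `x`-exponent `≥ 4`
  (`example1_support_xw`);
* `example2_seq_mem_pow` : `F²_k ∈ (x, w)^{p³}` for all `k` (hence `f_k = z^{p³} + F²_k ∈ (z, x, w)^{p³}`,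
  `example2_equation_mem_pow`).

Reading: at every stage the smooth coordinate subspace `V(z, x, w)` (dimension `3`, resp. `2`) passes
through the point blown up and `f_k` has order `≥ q = ord₀ f_k` along it (`q = 8`, resp. `p³`; the
order at the origin is `≤ q` because of the monomial `z^q`, `example1_coeff_zq`), i.e. `V(z,x,w)` lies
in the equimultiple (top multiplicity) locus of the hypersurface `f_k = 0`: the singularity is NOT
isolated and a positive-dimensional equimultiple regular centre is admissible at every step — the point
centres of the cycles are a choice, never forced.  (For the height-one arena of the thesis the cycles are
moreover of the wrong type: exponent `e = 3`, not `1`.)  Consequently neither cycle is a candidate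
counterexample to `IsolatedForcedTermination`; an unrefuted candidate would have to be isolated at every
stage, which [cite: HauserPerlega2019, §6] calls "hard to construct".
-/

-- single-problem summit: the doubled namespace component `ResolutionOfSingularities` is forced by the tree layout
set_option linter.dupNamespace false

namespace Summit.ResolutionOfSingularities.ResolutionOfSingularities.Theorems.IsolatedForcedTermination.Negative

open MvPolynomial Finset
open scoped BigOperators
open Literature.Barriers.ResolutionOfSingularities.HauserPerlega

variable {K : Type*} [CommRing K]

/-! ## Monomial ideals `(x, w)^N` -/

/-- Splitting an exponent vector in five variables off its `x`- and `w`-parts. [folklore] -/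
theorem exp5_split (e : Fin 5 →₀ ℕ) :
    e = V 0 (e 1) (e 2) (e 3) 0 + (Finsupp.single 0 (e 0) + Finsupp.single 4 (e 4)) := by
  rw [Finsupp.ext_iff, forall_fin5]
  simp

/-- A monomial `c·xᵃyᵇuᶜvᵈwᵉ` with `a + e ≥ N` lies in `(x, w)^N`. [folklore] -/
theorem monomial5_mem_pow (e : Fin 5 →₀ ℕ) (c : K) {N : ℕ} (hN : N ≤ e 0 + e 4) :
    monomial e c ∈ (Ideal.span {X 0, X 4} : Ideal (MvPolynomial (Fin 5) K)) ^ N := by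
  have h0 : (X 0 : MvPolynomial (Fin 5) K) ∈ (Ideal.span {X 0, X 4} : Ideal (MvPolynomial (Fin 5) K)) :=
    Ideal.subset_span (by simp)
  have h4 : (X 4 : MvPolynomial (Fin 5) K) ∈ (Ideal.span {X 0, X 4} : Ideal (MvPolynomial (Fin 5) K)) :=
    Ideal.subset_span (by simp)
  have hxw : (X 0 : MvPolynomial (Fin 5) K) ^ e 0 * X 4 ^ e 4 ∈
      (Ideal.span {X 0, X 4} : Ideal (MvPolynomial (Fin 5) K)) ^ (e 0 + e 4) := by
    rw [pow_add]
    exact Ideal.mul_mem_mul (Ideal.pow_mem_pow h0 _) (Ideal.pow_mem_pow h4 _)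
  have heq : monomial e c =
      monomial (V 0 (e 1) (e 2) (e 3) 0) c * ((X 0 : MvPolynomial (Fin 5) K) ^ e 0 * X 4 ^ e 4) := by
    rw [X_pow_eq_monomial, X_pow_eq_monomial, monomial_mul, monomial_mul, mul_one, mul_one,
      ← exp5_split e]
  rw [heq]
  exact Ideal.pow_le_pow_right hN (Ideal.mul_mem_left _ _ hxw)

/-- A polynomial all of whose monomials have `x`-exponent plus `w`-exponent `≥ N` lies in `(x, w)^N`.
[folklore] -/
theorem mem_pow5_of_support {F : MvPolynomial (Fin 5) K} {N : ℕ}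
    (h : ∀ e ∈ F.support, N ≤ e 0 + e 4) :
    F ∈ (Ideal.span {X 0, X 4} : Ideal (MvPolynomial (Fin 5) K)) ^ N := by
  rw [F.as_sum]
  exact Ideal.sum_mem _ (fun e he => monomial5_mem_pow e _ (h e he))

/-- Splitting an exponent vector in four variables off its `x`- and `w`-parts. [folklore] -/
theorem exp4_split (e : Fin 4 →₀ ℕ) :
    e = V4 0 (e 1) (e 2) 0 + (Finsupp.single 0 (e 0) + Finsupp.single 3 (e 3)) := by
  rw [Finsupp.ext_iff, forall_fin4]
  simp

/-- A monomial `c·xᵃyᵇvᶜwᵈ` with `a + d ≥ N` lies in `(x, w)^N`. [folklore] -/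
theorem monomial4_mem_pow (e : Fin 4 →₀ ℕ) (c : K) {N : ℕ} (hN : N ≤ e 0 + e 3) :
    monomial e c ∈ (Ideal.span {X 0, X 3} : Ideal (MvPolynomial (Fin 4) K)) ^ N := by
  have h0 : (X 0 : MvPolynomial (Fin 4) K) ∈ (Ideal.span {X 0, X 3} : Ideal (MvPolynomial (Fin 4) K)) :=
    Ideal.subset_span (by simp)
  have h3 : (X 3 : MvPolynomial (Fin 4) K) ∈ (Ideal.span {X 0, X 3} : Ideal (MvPolynomial (Fin 4) K)) :=
    Ideal.subset_span (by simp)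
  have hxw : (X 0 : MvPolynomial (Fin 4) K) ^ e 0 * X 3 ^ e 3 ∈
      (Ideal.span {X 0, X 3} : Ideal (MvPolynomial (Fin 4) K)) ^ (e 0 + e 3) := by
    rw [pow_add]
    exact Ideal.mul_mem_mul (Ideal.pow_mem_pow h0 _) (Ideal.pow_mem_pow h3 _)
  have heq : monomial e c =
      monomial (V4 0 (e 1) (e 2) 0) c * ((X 0 : MvPolynomial (Fin 4) K) ^ e 0 * X 3 ^ e 3) := by
    rw [X_pow_eq_monomial, X_pow_eq_monomial, monomial_mul, monomial_mul, mul_one, mul_one,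
      ← exp4_split e]
  rw [heq]
  exact Ideal.pow_le_pow_right hN (Ideal.mul_mem_left _ _ hxw)

/-- A polynomial all of whose monomials have `x`-exponent plus `w`-exponent `≥ N` lies in `(x, w)^N`
(four variables). [folklore] -/
theorem mem_pow4_of_support {F : MvPolynomial (Fin 4) K} {N : ℕ}
    (h : ∀ e ∈ F.support, N ≤ e 0 + e 3) :
    F ∈ (Ideal.span {X 0, X 3} : Ideal (MvPolynomial (Fin 4) K)) ^ N := by
  rw [F.as_sum]
  exact Ideal.sum_mem _ (fun e he => monomial4_mem_pow e _ (h e he))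

/-! ## First example (characteristic `2`): `F_k ∈ (x, w)⁸` and `x⁴ ∣ F_k` at every stage -/

/-- Every state shape of the first example has all its monomials divisible by `x⁴` and of
`(x, w)`-degree `≥ 8`. [cite: HauserPerlega2019, §4 First example (0)–(7)] -/
theorem example1_xw_of_stateShape {m i : ℕ} {G : MvPolynomial (Fin 5) K}
    (h : Example1.StateShape m i G) : ∀ e ∈ G.support, 4 ≤ e 0 ∧ 8 ≤ e 0 + e 4 := by
  have hd : 2 ≤ Example1.dOf m := by unfold Example1.dOf; omega
  intro e he
  unfold Example1.StateShape at h
  split_ifs at h with h0 h1 h2 h4 h5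
  · obtain ⟨ex, ey, eu, ew, hex, -, -, hew, hR, -, -⟩ := h
    have := hR e he; rw [eq_V_iff] at this; omega
  · obtain ⟨ex, ew, hex, -, -, hR, -, -⟩ := h
    have := hR e he; omega
  · obtain ⟨ex, ew, hex, hew, hR, -, -⟩ := h
    have := hR e he; omega
  · obtain ⟨ex, eu, ev, ew, hex, -, -, hew, hR, -, -⟩ := h
    have := hR e he; omega
  · obtain ⟨ex, eu, ew, hex, -, hew, hR, -, -⟩ := h
    have := hR e he; omega
  · obtain ⟨ex, ey, eu, ew, hex, -, -, hew, hR, -, -⟩ := h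
    have := hR e he; rw [eq_V_iff] at this; omega

/-- The accumulated exchange of `y` and `u` fixes `x`. [folklore] -/
theorem example1_sw_zero (m : ℕ) : Example1.sw m 0 = 0 := by
  induction m with
  | zero => simp [Example1.sw]
  | succ m ih =>
    rw [Example1.sw_succ, Equiv.Perm.coe_mul, Function.comp_apply, ih]
    exact Equiv.swap_apply_of_ne_of_ne (by decide) (by decide)

/-- The accumulated exchange of `y` and `u` fixes `w`. [folklore] -/
theorem example1_sw_four (m : ℕ) : Example1.sw m 4 = 4 := by
  induction m with
  | zero => simp [Example1.sw]
  | succ m ih =>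
    rw [Example1.sw_succ, Equiv.Perm.coe_mul, Function.comp_apply, ih]
    exact Equiv.swap_apply_of_ne_of_ne (by decide) (by decide)

/-- The inverse exchange fixes `x`. [folklore] -/
theorem example1_sw_symm_zero (m : ℕ) : (Example1.sw m).symm 0 = 0 := by
  rw [Equiv.symm_apply_eq]; exact (example1_sw_zero m).symm

/-- The inverse exchange fixes `w`. [folklore] -/
theorem example1_sw_symm_four (m : ℕ) : (Example1.sw m).symm 4 = 4 := by
  rw [Equiv.symm_apply_eq]; exact (example1_sw_four m).symm

/-- **At every stage `k` of the first example, every monomial of `F_k` is divisible by `x⁴` and has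
`(x, w)`-degree `≥ 8`.** [cite: HauserPerlega2019, §4 First example] -/
theorem example1_support_xw [CharP K 2] [Nontrivial K] (k : ℕ) :
    ∀ e ∈ (Example1.seq K k).support, 4 ≤ e 0 ∧ 8 ≤ e 0 + e 4 := by
  intro e he
  have hS := example1_xw_of_stateShape (Example1.stateShape_seq (K := K) k)
  rw [← Example1.rename_symm_rename (Example1.sw (Example1.pos k).1) (Example1.seq K k),
    mem_support_rename_equiv, Equiv.symm_symm] at he
  have h := hS _ he
  simp only [Finsupp.mapDomain_equiv_apply, example1_sw_symm_zero, example1_sw_symm_four] at h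
  exact h

/-- **`F_k ∈ (x, w)⁸` at every stage of the first example**: the residual part of
`f_k = z⁸ + F_k` vanishes to order `8` along `V(x, w)`. [cite: HauserPerlega2019, §4 First example] -/
theorem example1_seq_mem_pow [CharP K 2] [Nontrivial K] (k : ℕ) :
    Example1.seq K k ∈ (Ideal.span {X 0, X 4} : Ideal (MvPolynomial (Fin 5) K)) ^ 8 :=
  mem_pow5_of_support (fun e he => (example1_support_xw k e he).2)

/-- **`x⁴ ∣ F_k` at every stage of the first example.** [cite: HauserPerlega2019, §4 First example] -/
theorem example1_X_pow_four_dvd [CharP K 2] [Nontrivial K] (k : ℕ) :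
    (X 0 : MvPolynomial (Fin 5) K) ^ 4 ∣ Example1.seq K k := by
  rw [X_pow_eq_monomial, monomial_one_dvd_iff_modMonomial_eq_zero]
  ext d
  rw [coeff_zero]
  by_cases hd : Finsupp.single (0 : Fin 5) 4 ≤ d
  · exact coeff_modMonomial_of_le _ hd
  · rw [coeff_modMonomial_of_not_le _ hd, ← notMem_support_iff]
    intro hmem
    exact hd (Finsupp.single_le_iff.mpr (example1_support_xw k d hmem).1)

/-- **The equation `f_k = z⁸ + F_k(x,y,u,v,w)` lies in `(z, x, w)⁸`** (variables `z, x, y, u, v, w`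
numbered `0, …, 5`; `F_k` re-indexed by `Fin.succ`): the regular threefold `V(z, x, w)` through the
point blown up lies in the locus of order `≥ 8 = ord₀ f_k`, i.e. in the equimultiple locus — an
admissible positive-dimensional centre at every stage. [cite: HauserPerlega2019, §1 and §5] -/
theorem example1_equation_mem_pow [CharP K 2] [Nontrivial K] (k : ℕ) :
    (X 0 : MvPolynomial (Fin 6) K) ^ 8 + rename Fin.succ (Example1.seq K k) ∈
      (Ideal.span {X 0, X 1, X 5} : Ideal (MvPolynomial (Fin 6) K)) ^ 8 := by
  refine Ideal.add_mem _ (Ideal.pow_mem_pow (Ideal.subset_span (by simp)) 8) ?_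
  have hmap : Ideal.map (rename Fin.succ : MvPolynomial (Fin 5) K →ₐ[K] MvPolynomial (Fin 6) K)
      ((Ideal.span {X 0, X 4} : Ideal (MvPolynomial (Fin 5) K)) ^ 8) ≤
      (Ideal.span {X 0, X 1, X 5} : Ideal (MvPolynomial (Fin 6) K)) ^ 8 := by
    rw [Ideal.map_pow, Ideal.map_span, Set.image_pair, rename_X, rename_X]
    refine Ideal.pow_right_mono (Ideal.span_mono ?_) 8
    have h1 : (Fin.succ (0 : Fin 5) : Fin 6) = 1 := by decide
    have h5 : (Fin.succ (4 : Fin 5) : Fin 6) = 5 := by decide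
    rw [h1, h5]
    intro q hq
    simp only [Set.mem_insert_iff, Set.mem_singleton_iff] at hq ⊢
    rcases hq with hq | hq
    · exact Or.inr (Or.inl hq)
    · exact Or.inr (Or.inr hq)
  exact hmap (Ideal.mem_map_of_mem _ (example1_seq_mem_pow k))

/-- The monomial `z⁸` occurs in `f_k = z⁸ + F_k` with coefficient `1` (so `ord₀ f_k ≤ 8` over a
non-trivial ring): `F_k` involves no `z`. [folklore] -/
theorem example1_coeff_zq (k : ℕ) :
    coeff (Finsupp.single 0 8) ((X 0 : MvPolynomial (Fin 6) K) ^ 8 + rename Fin.succ (Example1.seq K k)) = 1 := by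
  classical
  rw [coeff_add, coeff_X_pow, if_pos rfl, coeff_rename_eq_zero, add_zero]
  intro u hu
  exfalso
  have h0 : (Finsupp.mapDomain Fin.succ u) 0 = 0 :=
    Finsupp.mapDomain_notin_range _ _ (by simp)
  rw [hu, Finsupp.single_eq_same] at h0
  exact absurd h0 (by decide)

/-! ## Second example (odd characteristic `p = 2h + 1`): `F_k ∈ (x, w)^{p³}` at every stage -/

/-- Every state of the second example has all its monomials of `(x, w)`-degree `≥ p³`.
[cite: HauserPerlega2019, §4 Second example (0)–(6)] -/
theorem example2_xw_of_stateShape {h c i : ℕ} {G : MvPolynomial (Fin 4) K}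
    (hG : Example2.StateShape h c i G) : ∀ e ∈ G.support, Example2.P3 h ≤ e 0 + e 3 := by
  have hq := Example2.le_qq h c
  have hx : Example2.dd h (c + 1) ≤ Example2.xaF h c := by rw [Example2.xaF_eq]; omega
  have hx' : Example2.dd h c ≤ Example2.xaF h c := by unfold Example2.xaF; omega
  intro e he
  unfold Example2.StateShape at hG
  split_ifs at hG with i0 i1 i2 i3 i4
  · obtain ⟨ka, kb, kr, ks, ew, hw, hR, -, -⟩ := hG
    have hP : Example2.P3 h ≤ ew + Example2.dd h c := by
      rw [hw]; exact Nat.le_mul_of_pos_right _ (Nat.succ_pos _)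
    have := hR e he; rw [eq_V4_iff] at this; omega
  · obtain ⟨k, ks, ew, hw, hR, -, -⟩ := hG
    have hP : Example2.P3 h ≤ ew + Example2.dd h c := by
      rw [hw]; exact Nat.le_mul_of_pos_right _ (Nat.succ_pos _)
    have := hR e he; omega
  · obtain ⟨k, ks, ew, r, hw, -, hR, -, -⟩ := hG
    have hP : Example2.P3 h ≤ ew + Example2.dd h c := by
      rw [hw]; exact Nat.le_mul_of_pos_right _ (Nat.succ_pos _)
    have := hR e he; omega
  · obtain ⟨k, ks, ew, Δ, hw, -, hR, -, -⟩ := hG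
    have hP : Example2.P3 h ≤ ew + Example2.dd h c := by
      rw [hw]; exact Nat.le_mul_of_pos_right _ (Nat.succ_pos _)
    have := hR e he; omega
  · obtain ⟨k, ks, ew, hw, hR, -, -⟩ := hG
    have hP : Example2.P3 h ≤ ew + Example2.dd h (c + 1) := by
      rw [hw]; exact Nat.le_mul_of_pos_right _ (Nat.succ_pos _)
    have := hR e he; omega
  · obtain ⟨ka, kb, kr, ks, ew, hw, hR, -, -⟩ := hG
    have hP : Example2.P3 h ≤ ew + Example2.dd h (c + 1) := by
      rw [hw]; exact Nat.le_mul_of_pos_right _ (Nat.succ_pos _)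
    have := hR e he; rw [eq_V4_iff] at this; omega

/-- **At every stage `k` of the second example, every monomial of `F_k` has `(x, w)`-degree `≥ p³`.**
[cite: HauserPerlega2019, §4 Second example] -/
theorem example2_support_xw {h : ℕ} [Fact (Nat.Prime (2 * h + 1))] [CharP K (2 * h + 1)] [IsDomain K]
    (h1 : 1 ≤ h) (k : ℕ) : ∀ e ∈ (Example2.seq K h k).support, Example2.P3 h ≤ e 0 + e 3 :=
  example2_xw_of_stateShape (Example2.stateShape_seq (K := K) h1 k)

/-- **`F_k ∈ (x, w)^{p³}` at every stage of the second example.**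
[cite: HauserPerlega2019, §4 Second example] -/
theorem example2_seq_mem_pow {h : ℕ} [Fact (Nat.Prime (2 * h + 1))] [CharP K (2 * h + 1)] [IsDomain K]
    (h1 : 1 ≤ h) (k : ℕ) :
    Example2.seq K h k ∈ (Ideal.span {X 0, X 3} : Ideal (MvPolynomial (Fin 4) K)) ^ Example2.P3 h :=
  mem_pow4_of_support (example2_support_xw h1 k)

/-- **The equation `f_k = z^{p³} + F_k(x,y,v,w)` lies in `(z, x, w)^{p³}`** (variables `z, x, y, v, w`
numbered `0, …, 4`): the regular surface `V(z, x, w)` through the point blown up lies in the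
equimultiple locus at every stage — "`(z,x,w)` … also admissible" holds along the whole sequence, not
only at the beginning. [cite: HauserPerlega2019, §5] -/
theorem example2_equation_mem_pow {h : ℕ} [Fact (Nat.Prime (2 * h + 1))] [CharP K (2 * h + 1)]
    [IsDomain K] (h1 : 1 ≤ h) (k : ℕ) :
    (X 0 : MvPolynomial (Fin 5) K) ^ Example2.P3 h + rename Fin.succ (Example2.seq K h k) ∈
      (Ideal.span {X 0, X 1, X 4} : Ideal (MvPolynomial (Fin 5) K)) ^ Example2.P3 h := by
  refine Ideal.add_mem _ (Ideal.pow_mem_pow (Ideal.subset_span (by simp)) _) ?_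
  have hmap : Ideal.map (rename Fin.succ : MvPolynomial (Fin 4) K →ₐ[K] MvPolynomial (Fin 5) K)
      ((Ideal.span {X 0, X 3} : Ideal (MvPolynomial (Fin 4) K)) ^ Example2.P3 h) ≤
      (Ideal.span {X 0, X 1, X 4} : Ideal (MvPolynomial (Fin 5) K)) ^ Example2.P3 h := by
    rw [Ideal.map_pow, Ideal.map_span, Set.image_pair, rename_X, rename_X]
    refine Ideal.pow_right_mono (Ideal.span_mono ?_) _
    have h1' : (Fin.succ (0 : Fin 4) : Fin 5) = 1 := by decide
    have h4 : (Fin.succ (3 : Fin 4) : Fin 5) = 4 := by decide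
    rw [h1', h4]
    intro q hq
    simp only [Set.mem_insert_iff, Set.mem_singleton_iff] at hq ⊢
    rcases hq with hq | hq
    · exact Or.inr (Or.inl hq)
    · exact Or.inr (Or.inr hq)
  exact hmap (Ideal.mem_map_of_mem _ (example2_seq_mem_pow h1 k))

end Summit.ResolutionOfSingularities.ResolutionOfSingularities.Theorems.IsolatedForcedTermination.Negative
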